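import Summits.ValiantsHypothesis.ValiantsHypothesis.Theorems.KPlusLogSqLawStaticPathTwoChains

/-!
# Route «KPlusLogSqLaw» — parametric max-weight independent set on a path: THE RIGHT CHAIN IS READ OFF THE LEFT CHAIN (one-chain particle criterion)

HONEST FRAMING.  Helper toward the crux `WeakLifting` (item `stmt-ValiantsHypothesis-19561`, route `KPlusLogSqLaw`, cell `pub-symmetroid`,
seat val-sym-lift-p4 g24, 2026-08-29) on the line of its witness-plan stub `stub_tridiagonalSectorB` (tropical twin of the STATIC tridiagonal
sector = parametric maximum-weight independent set on a path; located theory `HOME/val-sym-lift-p4/DELETION.md` §1.3 «chain form»: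
«EVENT ⟺ (next chain element above t, or n+1) − t is odd»).  Sequel of `…StaticPathTwoChains` (abstract greedy record chains).  In the abstract
setting (heights `S`, right records `Rr` with the greedy semantics of offset `e` on `[0, n]`, pairwise distinct heights) this file proves the
ONE-CHAIN PARTICLE CRITERION (`rightRec_iff_parity`): if every label strictly between `v` and `q` is CORRECT with respect to `S v` (even: above,
odd: below, parities shifted by `e`) and `q` is either the sentinel `n + 1` or a label `≤ n` that is INCORRECT with respect to `S v`, then

  `v` is a right record  iff  `v + e` and `q + e` have opposite parities.

In particular for a left record `v` with next left record `q` (or `q = n + 1`): `v` is a particle (left AND right record = uncovered position of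
the optimum) iff the next left record has the opposite parity (`rightRec_iff_parity_of_leftRec`) — the right chain is redundant on the left
chain, and the event test «`v ∈ J^R`» at a left flip of `v` becomes a parity test on the left chain alone (the chain form of DELETION §1.3, now
a kernel statement for every abstract two-chain state, pseudolines included).  Mechanism: scanning the right chain downward through the clean
stretch, the side of the current reference height relative to `S v` cannot change (evens sit above `S v` and only join below the reference, odds
sit below and only join above it), and that side is fixed at `q`.  Pure finite combinatorics; nothing here asserts anything about `WeakLifting`,
`TropicalB`, `KPlusLogSqLaw`, the stub in its window, `MatrixDescartes` (stmt-ValiantsHypothesis-18050) or `VP ≠ VNP`; the ORDER QUESTION stays open.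
-/

set_option linter.dupNamespace false
set_option autoImplicit false

namespace Summit.ValiantsHypothesis.ValiantsHypothesis.Theorems.KPlusLogSqLaw

open Finset Classical

namespace StaticPathFold

section OneChain

variable {β : Type*} [LinearOrder β]

/-- **ONE-CHAIN PARTICLE CRITERION.**  Right records with the greedy semantics (offset `e`) on `[0, n]`, pairwise distinct heights; `v < q ≤ n + 1`,
every label strictly between `v` and `q` (and `≤ n`) correct with respect to `S v`, and `q = n + 1` or `q` incorrect with respect to `S v`.  Then
`Rr v ↔ ¬ (Even (v + e) ↔ Even (q + e))`. [folklore] -/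
theorem rightRec_iff_parity (S : ℕ → β) (e n : ℕ) {Rr : ℕ → Prop} (hRn : Rr n)
    (hSemR : ∀ u r, u < r → r ≤ n → Rr r → (∀ q, u < q → q < r → ¬ Rr q) →
      (Rr u ↔ ((Even (u + e) → S u < S r) ∧ (¬ Even (u + e) → S r < S u))))
    (hdis : ∀ p q, p ≤ n → q ≤ n → p ≠ q → S p ≠ S q)
    {v q : ℕ} (hvn : v ≤ n) (hvq : v < q) (hqn : q ≤ n + 1)
    (hclean : ∀ w, v < w → w < q → w ≤ n → ¬ ((Even (w + e) → S w < S v) ∧ (¬ Even (w + e) → S v < S w)))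
    (hq : q = n + 1 ∨ (q ≤ n ∧ ((Even (q + e) → S q < S v) ∧ (¬ Even (q + e) → S v < S q)))) :
    Rr v ↔ ¬ (Even (v + e) ↔ Even (q + e)) := by
  -- strict sides of a correct label
  have hside : ∀ w, v < w → w < q → w ≤ n → (Even (w + e) → S v < S w) ∧ (¬ Even (w + e) → S w < S v) := by
    intro w h1 h2 h3
    have hne := hdis w v h3 hvn (by omega)
    have hc := hclean w h1 h2 h3
    by_cases hw : Even (w + e)
    · refine ⟨fun _ => ?_, fun h => absurd hw h⟩
      by_contra h
      exact hc ⟨fun _ => lt_of_le_of_ne (not_lt.mp h) hne, fun h' => absurd hw h'⟩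
    · refine ⟨fun h => absurd h hw, fun _ => ?_⟩
      by_contra h
      exact hc ⟨fun h' => absurd h' hw, fun _ => lt_of_le_of_ne (not_lt.mp h) (Ne.symm hne)⟩
  -- the side of every right record in `(v, q)`, of `q` itself if it is a right record, and of the nearest right record above `q` otherwise
  have hrec : ∀ d r, n - r = d → v < r → r < q → r ≤ n → Rr r → (S r < S v ↔ Even (q + e)) := by
    intro d
    induction d using Nat.strong_induction_on with
    | _ d ih =>
      intro r hd h1 h2 h3 hRr
      obtain ⟨hrE, hrO⟩ := hside r h1 h2 h3
      rcases Nat.lt_or_ge r n with hrn | hrn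
      · -- the nearest right record `r'` above `r`
        obtain ⟨r', hrr', hr'n, hRr', hno⟩ := exists_nearest_right hRn hrn
        have hbad := (hSemR r r' hrr' hr'n hRr' hno).mp hRr
        -- side of `r'`
        have hr' : S r' < S v ↔ Even (q + e) := by
          rcases Nat.lt_trichotomy r' q with h | h | h
          · exact ih (n - r') (by omega) r' rfl (by omega) h hr'n hRr'
          · subst h
            rcases hq with h | ⟨-, hqE, hqO⟩
            · omega
            · by_cases he : Even (r' + e)
              · exact iff_of_true (hqE he) he
              · exact iff_of_false (fun h' => lt_asymm h' (hqO he)) he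
          · -- `q ≤ n`, `q` is not a right record and `r'` is its nearest right record too
            rcases hq with hq1 | ⟨hqn', hqE, hqO⟩
            · omega
            · have hnq : ¬ Rr q := hno q h2 h
              rw [hSemR q r' h hr'n hRr' (fun q' h4 h5 => hno q' (by omega) h5)] at hnq
              have hne := hdis q r' hqn' hr'n (by omega)
              by_cases he : Even (q + e)
              · have h4 : ¬ S q < S r' := fun h' => hnq ⟨fun _ => h', fun h'' => absurd he h''⟩
                exact iff_of_true (lt_trans (lt_of_le_of_ne (not_lt.mp h4) (Ne.symm hne)) (hqE he)) he
              · have h4 : ¬ S r' < S q := fun h' => hnq ⟨fun h'' => absurd h'' he, fun _ => h'⟩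
                refine iff_of_false (fun h' => ?_) he
                exact lt_asymm (lt_trans (hqO he) (lt_of_le_of_ne (not_lt.mp h4) hne)) h'
        -- side of `r` from the side of `r'`
        by_cases he : Even (r + e)
        · have h4 : S v < S r := hrE he
          refine iff_of_false (fun h' => lt_asymm h' h4) (fun hqe => ?_)
          have h5 : S r < S r' := hbad.1 he
          exact lt_asymm (lt_trans h4 h5) (hr'.mpr hqe)
        · have h4 : S r < S v := hrO he
          refine iff_of_true h4 ?_
          have h5 : S r' < S r := hbad.2 he
          exact hr'.mp (lt_trans h5 h4)
      · -- `r = n`, so `q = n + 1`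
        have hrn' : r = n := by omega
        have hqn1 : q = n + 1 := by omega
        subst hrn'
        rw [hqn1]
        by_cases he : Even (r + e)
        · have h4 : S v < S r := hrE he
          have he' : ¬ Even (r + 1 + e) := fun h => by
            rw [add_right_comm, Nat.even_add_one] at h
            exact h he
          exact iff_of_false (fun h' => lt_asymm h' h4) he'
        · have h4 : S r < S v := hrO he
          have he' : Even (r + 1 + e) := by
            rw [add_right_comm, Nat.even_add_one]
            exact he
          exact iff_of_true h4 he'
  -- conclusion at `v`
  rcases Nat.lt_or_ge v n with hvn' | hvn'
  · obtain ⟨r, hvr, hrn, hRr, hno⟩ := exists_nearest_right hRn hvn'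
    have hr : S r < S v ↔ Even (q + e) := by
      rcases Nat.lt_trichotomy r q with h | h | h
      · exact hrec (n - r) r rfl hvr h hrn hRr
      · subst h
        rcases hq with h | ⟨-, hqE, hqO⟩
        · omega
        · by_cases he : Even (r + e)
          · exact iff_of_true (hqE he) he
          · exact iff_of_false (fun h' => lt_asymm h' (hqO he)) he
      · rcases hq with hq1 | ⟨hqn', hqE, hqO⟩
        · omega
        · have hnq : ¬ Rr q := hno q hvq h
          rw [hSemR q r h hrn hRr (fun q' h4 h5 => hno q' (by omega) h5)] at hnq
          have hne := hdis q r hqn' hrn (by omega)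
          by_cases he : Even (q + e)
          · have h4 : ¬ S q < S r := fun h' => hnq ⟨fun _ => h', fun h'' => absurd he h''⟩
            exact iff_of_true (lt_trans (lt_of_le_of_ne (not_lt.mp h4) (Ne.symm hne)) (hqE he)) he
          · have h4 : ¬ S r < S q := fun h' => hnq ⟨fun h'' => absurd h'' he, fun _ => h'⟩
            refine iff_of_false (fun h' => ?_) he
            exact lt_asymm (lt_trans (hqO he) (lt_of_le_of_ne (not_lt.mp h4) hne)) h'
    have hne := hdis v r hvn hrn (by omega)
    rw [hSemR v r hvr hrn hRr hno]
    by_cases he : Even (v + e)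
    · have e1 : ((Even (v + e) → S v < S r) ∧ (¬ Even (v + e) → S r < S v)) ↔ S v < S r :=
        ⟨fun h => h.1 he, fun h => ⟨fun _ => h, fun h' => absurd he h'⟩⟩
      rw [e1]
      constructor
      · intro h h'
        exact lt_asymm h (hr.mpr (h'.mp he))
      · intro h
        have h2 : ¬ Even (q + e) := fun h3 => h (iff_of_true he h3)
        exact lt_of_le_of_ne (not_lt.mp (fun h3 => h2 (hr.mp h3))) hne
    · have e1 : ((Even (v + e) → S v < S r) ∧ (¬ Even (v + e) → S r < S v)) ↔ S r < S v :=
        ⟨fun h => h.2 he, fun h => ⟨fun h' => absurd h' he, fun _ => h⟩⟩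
      rw [e1, hr]
      constructor
      · intro h h'
        exact he (h'.mpr h)
      · intro h
        by_contra h2
        exact h (iff_of_false he h2)
  · -- `v = n`: a right record, and `q = n + 1`
    have hv : v = n := by omega
    subst hv
    have hqn1 : q = v + 1 := by omega
    subst hqn1
    refine iff_of_true hRn (fun h => ?_)
    rw [add_right_comm, Nat.even_add_one] at h
    exact iff_not_self h

/-- **particles from the left chain alone**: for a LEFT record `v ≤ n` whose next left record is `q` (or `q = n + 1` if there is none), `v` is
a right record iff `v + e` and `q + e` have opposite parities. [folklore] -/
theorem rightRec_iff_parity_of_leftRec (S : ℕ → β) (e n : ℕ) {Lr Rr : ℕ → Prop} (hRn : Rr n)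
    (hSem : ∀ p u, p < u → u ≤ n → Lr p → (∀ q, p < q → q < u → ¬ Lr q) →
      (Lr u ↔ ((Even (u + e) → S u < S p) ∧ (¬ Even (u + e) → S p < S u))))
    (hSemR : ∀ u r, u < r → r ≤ n → Rr r → (∀ q, u < q → q < r → ¬ Rr q) →
      (Rr u ↔ ((Even (u + e) → S u < S r) ∧ (¬ Even (u + e) → S r < S u))))
    (hdis : ∀ p q, p ≤ n → q ≤ n → p ≠ q → S p ≠ S q)
    {v q : ℕ} (hvn : v ≤ n) (hvq : v < q) (hqn : q ≤ n + 1) (hLv : Lr v)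
    (hno : ∀ w, v < w → w < q → ¬ Lr w) (hq : q = n + 1 ∨ (q ≤ n ∧ Lr q)) :
    Rr v ↔ ¬ (Even (v + e) ↔ Even (q + e)) := by
  have hclean : ∀ w, v < w → w < q → w ≤ n → ¬ ((Even (w + e) → S w < S v) ∧ (¬ Even (w + e) → S v < S w)) := by
    have h := (noRec_iff_good S e n hSem hLv (show min q (n + 1) ≤ n + 1 from min_le_right _ _)).mp
      (fun w h1 h2 => hno w h1 (lt_of_lt_of_le h2 (min_le_left _ _)))
    exact fun w h1 h2 h3 => h w h1 (lt_min h2 (by omega))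
  refine rightRec_iff_parity S e n hRn hSemR hdis hvn hvq hqn hclean ?_
  rcases hq with h | ⟨hqn', hLq⟩
  · exact Or.inl h
  · exact Or.inr ⟨hqn', (hSem v q hvq hqn' hLv (fun w h1 h2 => hno w h1 h2)).mp hLq⟩

end OneChain

end StaticPathFold

end Summit.ValiantsHypothesis.ValiantsHypothesis.Theorems.KPlusLogSqLaw
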